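import Mathlib.Algebra.Module.Submodule.LinearMap
import Mathlib.Algebra.Module.LinearMap.End
import Mathlib.Algebra.BigOperators.Fin
import Mathlib.Data.Nat.Choose.Bounds
import Mathlib.Data.Nat.Factorial.BigOperators
import Mathlib.Data.Real.Basic
import Mathlib.Algebra.Order.BigOperators.Ring.Finset
import HarnessLib

/-!
# Factorial growth of words of operators that raise a filtration by one with linear operator bounds

Topic `Analysis/OperatorTheory`; namespace `Literature.Analysis.OperatorTheory`; THEOREMS ONLY (no `def`, no named fact, no instance, no notation, no `sorry`);
Mathlib only; any ring of scalars `R`.  Cell `hodgecm-mathlib`, F0∕P3, T1a arch line, ROAD-GLOB (A6 #92 at `U(2,1)`, A-p14 (g24) v1 + LEAD F0P3b-p01 (g3) v1.1 §1(a)): the GENERIC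
half **G2** of brick «FB» = the factorial bound (FB); the `U(2,1)` input G1 (`‖ρ(X)|_{F n}‖ ≤ ‖X‖ (a + b n)`) is a hypothesis here.

THE STATEMENT ([HarishChandra1953, §9 (well-behaved vectors)]; [Nelson1959, §2 Lemma 5.1 (analytic domination)]; [KnappVogan1995, Thm. 0.6 proof sketch]).  Let
`T : 𝔤 → End V` be operators on a module `V`, `F : ℕ → Submodule V` a chain with `T X (F n) ⊆ F (n+1)`, `p : V → ℝ≥0` and `ν : 𝔤 → ℝ≥0` size functions
(in the application `p v = ‖ι v‖` in the Hilbert completion and `ν X = ‖X‖`), and `p (T X v) ≤ ν X · (a + b n) · p v` on `F n` (`a, b ≥ 0`).  Then for every word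
`X : Fin m → 𝔤` and `v ∈ F n₀`:
* `prod_apply_mem_filtration` — `T X₀ ⋯ T X_{m−1} v ∈ F (n₀ + m)`;
* **`size_prod_apply_le_prod`** — `p (T X₀ ⋯ T X_{m−1} v) ≤ (∏ᵢ ν Xᵢ) · (∏_{j<m} (a + b (n₀ + j))) · p v`;
* `prod_linear_le_two_pow_mul_factorial_mul_pow` — the arithmetic `∏_{j<m} (a + b (n₀+j)) ≤ 2^{n₀} · m! · (2 max(a,b))^m` (via `a + b(n₀+j) ≤ max(a,b)(n₀+1+j)`,
  `(n₀+1)⋯(n₀+m) = m! · C(n₀+m, m) ≤ m! · 2^{n₀+m}`);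
* **`size_prod_apply_le_factorial`** — THE FACTORIAL BOUND (FB): `p (T X₀ ⋯ T X_{m−1} v) ≤ (2^{n₀} p v) · m! · (2 max(a,b))^m · ∏ᵢ ν Xᵢ` with the RATE
  `K = 2 max(a,b)` INDEPENDENT of `v` (only the constant `C_v = 2^{n₀} p v` depends on the level of `v`), i.e. the ROAD's currency
  `∃ K ≥ 0, ∀ v, ∃ C, ∀ m X, p (word v) ≤ C * m! * K^m * ∏ ν Xᵢ` for `v ∈ ⋃ F n` (`exists_rate_forall_exists_const`).
HONEST LABEL: closes no registered stub by itself.  HC_CM is proved only modulo the 2 remaining named inputs (hLiu418, h413) until rung 0 closes.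

## References
* Harish-Chandra, *Representations of a semisimple Lie group on a Banach space. I*, Trans. AMS 75 (1953), §9 [HarishChandra1953].
* E. Nelson, *Analytic vectors*, Ann. of Math. 70 (1959), §2 [Nelson1959].
* A. W. Knapp, D. A. Vogan, *Cohomological Induction and Unitary Representations* (1995), Thm. 0.6 [KnappVogan1995].
-/

set_option autoImplicit false

namespace Literature.Analysis.OperatorTheory

open Finset

universe u v

variable {R : Type*} [Ring R] {𝔤 : Type u} {V : Type v} [AddCommGroup V] [Module R V]

/-! ## §1 Words raise the filtration -/

/-- A word `T X₀ ⋯ T X_{m−1}` maps `F n₀` into `F (n₀ + m)` when each `T X` raises the chain by one. [cite: HarishChandra1953, §9] -/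
theorem prod_apply_mem_filtration (T : 𝔤 → Module.End R V) (F : ℕ → Submodule R V)
    (h1 : ∀ (X : 𝔤) (n : ℕ), ∀ v ∈ F n, T X v ∈ F (n + 1)) (n₀ : ℕ) :
    ∀ (m : ℕ) (X : Fin m → 𝔤), ∀ v ∈ F n₀, (List.ofFn fun i => T (X i)).prod v ∈ F (n₀ + m) := by
  intro m
  induction m with
  | zero => intro X v hv; simpa using hv
  | succ m ih =>
    intro X v hv
    rw [List.ofFn_succ, List.prod_cons, Module.End.mul_apply]
    have hw := ih (fun i => X i.succ) v hv
    have := h1 (X 0) (n₀ + m) _ hw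
    simpa [Nat.add_assoc] using this

/-! ## §2 The product bound -/

/-- **`p (T X₀ ⋯ T X_{m−1} v) ≤ (∏ᵢ ν Xᵢ) · ∏_{j<m} (a + b (n₀ + j)) · p v`** for `v ∈ F n₀`, when `p (T X w) ≤ ν X (a + b n) p w` on `F n` and every `T X`
raises the chain by one (induction on the word, innermost letter at level `n₀`). [cite: HarishChandra1953, §9] [cite: Nelson1959, §2] -/
theorem size_prod_apply_le_prod (T : 𝔤 → Module.End R V) (F : ℕ → Submodule R V) (p : V → ℝ) (ν : 𝔤 → ℝ) (hν : ∀ X, 0 ≤ ν X)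
    {a b : ℝ} (ha : 0 ≤ a) (hb : 0 ≤ b)
    (h1 : ∀ (X : 𝔤) (n : ℕ), ∀ v ∈ F n, T X v ∈ F (n + 1))
    (h2 : ∀ (X : 𝔤) (n : ℕ), ∀ v ∈ F n, p (T X v) ≤ ν X * (a + b * n) * p v) (n₀ : ℕ) :
    ∀ (m : ℕ) (X : Fin m → 𝔤), ∀ v ∈ F n₀,
      p ((List.ofFn fun i => T (X i)).prod v) ≤ (∏ i, ν (X i)) * (∏ j ∈ range m, (a + b * (n₀ + j : ℕ))) * p v := by
  intro m
  induction m with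
  | zero => intro X v _; simp
  | succ m ih =>
    intro X v hv
    rw [List.ofFn_succ, List.prod_cons, Module.End.mul_apply, Fin.prod_univ_succ, Finset.prod_range_succ]
    set w := (List.ofFn fun i => T (X i.succ)).prod v with hw
    have hwF : w ∈ F (n₀ + m) := prod_apply_mem_filtration T F h1 n₀ m (fun i => X i.succ) v hv
    have hpw : p w ≤ (∏ i : Fin m, ν (X i.succ)) * (∏ j ∈ range m, (a + b * (n₀ + j : ℕ))) * p v := ih (fun i => X i.succ) v hv
    have hstep : p (T (X 0) w) ≤ ν (X 0) * (a + b * (n₀ + m : ℕ)) * p w := h2 (X 0) (n₀ + m) w hwF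
    have hcoef : 0 ≤ ν (X 0) * (a + b * (n₀ + m : ℕ)) := mul_nonneg (hν _) (add_nonneg ha (mul_nonneg hb (Nat.cast_nonneg _)))
    calc p (T (X 0) w) ≤ ν (X 0) * (a + b * (n₀ + m : ℕ)) * p w := hstep
      _ ≤ ν (X 0) * (a + b * (n₀ + m : ℕ)) * ((∏ i : Fin m, ν (X i.succ)) * (∏ j ∈ range m, (a + b * (n₀ + j : ℕ))) * p v) :=
          mul_le_mul_of_nonneg_left hpw hcoef
      _ = ν (X 0) * (∏ i : Fin m, ν (X i.succ)) * ((∏ j ∈ range m, (a + b * (n₀ + j : ℕ))) * (a + b * (n₀ + m : ℕ))) * p v := by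
          push_cast; ring

/-! ## §3 Arithmetic: `∏_{j<m} (a + b (n₀ + j)) ≤ 2^{n₀} · m! · (2 max(a,b))^m` -/

/-- `(n₀+1)(n₀+2)⋯(n₀+m) ≤ 2^{n₀+m} · m!` (it equals `m! · C(n₀+m, m)` and `C ≤ 2^{n₀+m}`). [cite: Nelson1959, §2] -/
theorem prod_range_add_succ_le (n₀ m : ℕ) : (∏ j ∈ range m, (n₀ + 1 + j)) ≤ 2 ^ (n₀ + m) * m.factorial := by
  rw [← Nat.ascFactorial_eq_prod_range, Nat.ascFactorial_eq_factorial_mul_choose, mul_comm]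
  exact Nat.mul_le_mul_right _ (Nat.choose_le_two_pow _ _)

/-- **`∏_{j<m} (a + b (n₀ + j)) ≤ 2^{n₀} · m! · (2 max(a,b))^m`** for `a, b ≥ 0`. [cite: Nelson1959, §2] -/
theorem prod_linear_le_two_pow_mul_factorial_mul_pow {a b : ℝ} (ha : 0 ≤ a) (hb : 0 ≤ b) (n₀ m : ℕ) :
    (∏ j ∈ range m, (a + b * (n₀ + j : ℕ))) ≤ (2 : ℝ) ^ n₀ * m.factorial * (2 * max a b) ^ m := by
  -- each factor is at most `max a b * (n₀ + 1 + j)`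
  have hM : 0 ≤ max a b := le_max_of_le_left ha
  have hfac : ∀ j : ℕ, a + b * (n₀ + j : ℕ) ≤ max a b * ((n₀ + 1 + j : ℕ) : ℝ) := by
    intro j
    have h1 : a ≤ max a b * 1 := by rw [mul_one]; exact le_max_left a b
    have h2 : b * (n₀ + j : ℕ) ≤ max a b * (n₀ + j : ℕ) := mul_le_mul_of_nonneg_right (le_max_right a b) (Nat.cast_nonneg _)
    calc a + b * (n₀ + j : ℕ) ≤ max a b * 1 + max a b * (n₀ + j : ℕ) := add_le_add h1 h2
      _ = max a b * ((n₀ + 1 + j : ℕ) : ℝ) := by push_cast; ring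
  have hle : (∏ j ∈ range m, (a + b * (n₀ + j : ℕ))) ≤ ∏ j ∈ range m, (max a b * ((n₀ + 1 + j : ℕ) : ℝ)) :=
    Finset.prod_le_prod (fun j _ => add_nonneg ha (mul_nonneg hb (Nat.cast_nonneg _))) (fun j _ => hfac j)
  refine hle.trans ?_
  rw [Finset.prod_mul_distrib, Finset.prod_const, Finset.card_range]
  -- the integer product
  have hnat : ((∏ j ∈ range m, ((n₀ + 1 + j : ℕ) : ℝ))) ≤ (2 : ℝ) ^ (n₀ + m) * m.factorial := by
    have h := prod_range_add_succ_le n₀ m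
    have h' : ((∏ j ∈ range m, (n₀ + 1 + j) : ℕ) : ℝ) ≤ ((2 ^ (n₀ + m) * m.factorial : ℕ) : ℝ) := by exact_mod_cast h
    simpa [Nat.cast_prod, Nat.cast_mul, Nat.cast_pow] using h'
  calc max a b ^ m * ∏ j ∈ range m, ((n₀ + 1 + j : ℕ) : ℝ) ≤ max a b ^ m * ((2 : ℝ) ^ (n₀ + m) * m.factorial) :=
        mul_le_mul_of_nonneg_left hnat (pow_nonneg hM m)
    _ = (2 : ℝ) ^ n₀ * m.factorial * (2 * max a b) ^ m := by rw [pow_add, mul_pow]; ring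

/-! ## §4 The factorial bound (FB) with a rate independent of the vector -/

/-- **THE FACTORIAL BOUND (FB).**  Under the hypotheses of `size_prod_apply_le_prod`, for `v ∈ F n₀` and every word `X : Fin m → 𝔤`:
`p (T X₀ ⋯ T X_{m−1} v) ≤ (2^{n₀} p v) · m! · (2 max(a,b))^m · ∏ᵢ ν Xᵢ` — rate `K = 2 max(a,b)` independent of `v`.
[cite: HarishChandra1953, §9] [cite: Nelson1959, §2] [cite: KnappVogan1995, Thm. 0.6] -/
theorem size_prod_apply_le_factorial (T : 𝔤 → Module.End R V) (F : ℕ → Submodule R V) (p : V → ℝ) (ν : 𝔤 → ℝ) (hp : ∀ v, 0 ≤ p v)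
    (hν : ∀ X, 0 ≤ ν X) {a b : ℝ} (ha : 0 ≤ a) (hb : 0 ≤ b)
    (h1 : ∀ (X : 𝔤) (n : ℕ), ∀ v ∈ F n, T X v ∈ F (n + 1))
    (h2 : ∀ (X : 𝔤) (n : ℕ), ∀ v ∈ F n, p (T X v) ≤ ν X * (a + b * n) * p v) {n₀ : ℕ} {v : V} (hv : v ∈ F n₀)
    (m : ℕ) (X : Fin m → 𝔤) :
    p ((List.ofFn fun i => T (X i)).prod v) ≤ ((2 : ℝ) ^ n₀ * p v) * m.factorial * (2 * max a b) ^ m * ∏ i, ν (X i) := by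
  have h := size_prod_apply_le_prod T F p ν hν ha hb h1 h2 n₀ m X v hv
  have hprod : 0 ≤ ∏ i, ν (X i) := Finset.prod_nonneg fun i _ => hν _
  calc p ((List.ofFn fun i => T (X i)).prod v) ≤ (∏ i, ν (X i)) * (∏ j ∈ range m, (a + b * (n₀ + j : ℕ))) * p v := h
    _ ≤ (∏ i, ν (X i)) * ((2 : ℝ) ^ n₀ * m.factorial * (2 * max a b) ^ m) * p v :=
        mul_le_mul_of_nonneg_right (mul_le_mul_of_nonneg_left (prod_linear_le_two_pow_mul_factorial_mul_pow ha hb n₀ m) hprod) (hp v)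
    _ = ((2 : ℝ) ^ n₀ * p v) * m.factorial * (2 * max a b) ^ m * ∏ i, ν (X i) := by ring

/-- **(FB) in the ROAD's currency**: one rate `K ≥ 0` for all vectors of the exhausted space, a constant per vector:
`∃ K ≥ 0, ∀ v ∈ ⋃ F n, ∃ C, ∀ m X, p (word v) ≤ C * m! * K^m * ∏ ν Xᵢ`. [cite: HarishChandra1953, §9] [cite: Nelson1959, §2] -/
theorem exists_rate_forall_exists_const (T : 𝔤 → Module.End R V) (F : ℕ → Submodule R V) (p : V → ℝ) (ν : 𝔤 → ℝ) (hp : ∀ v, 0 ≤ p v)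
    (hν : ∀ X, 0 ≤ ν X) {a b : ℝ} (ha : 0 ≤ a) (hb : 0 ≤ b)
    (h1 : ∀ (X : 𝔤) (n : ℕ), ∀ v ∈ F n, T X v ∈ F (n + 1))
    (h2 : ∀ (X : 𝔤) (n : ℕ), ∀ v ∈ F n, p (T X v) ≤ ν X * (a + b * n) * p v) :
    ∃ K : ℝ, 0 ≤ K ∧ ∀ v : V, (∃ n, v ∈ F n) → ∃ C : ℝ, ∀ (m : ℕ) (X : Fin m → 𝔤),
      p ((List.ofFn fun i => T (X i)).prod v) ≤ C * m.factorial * K ^ m * ∏ i, ν (X i) := by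
  refine ⟨2 * max a b, mul_nonneg zero_le_two (le_max_of_le_left ha), fun v ⟨n₀, hv⟩ => ⟨(2 : ℝ) ^ n₀ * p v, fun m X => ?_⟩⟩
  exact size_prod_apply_le_factorial T F p ν hp hν ha hb h1 h2 hv m X

end Literature.Analysis.OperatorTheory
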